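import Summits.Schanuel.Schanuel.Theorems.ZilberEacBranchSecondOrderGrowth
import Summits.Schanuel.Schanuel.Theorems.ZilberEacCurveGraphFibreCase
import Summits.Schanuel.Schanuel.Theorems.ZilberEacEllipticBaseExample
import HarnessLib

/-!
# Arbitrary base branches, XXVII: the DIAGONAL PARABOLA `(x₁ − x₀)² = x₀` — a base curve with a
# RATIONAL asymptotic direction whose constant fibres are in Mantova–Masser's case AND dense

HONEST FRAMING.  Cell `pub-schanuel` (Zilber's Exponential-Algebraic Closedness, case ladder;
host summit Schanuel), seat 2, gen 28.  Lines of rational slope are excluded from Mantova–Masser's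
case, and over curves ASYMPTOTIC to a rational direction the top phase coefficient is purely
imaginary (the residue class of files XIX–XXII: the method of the leading term is silent).  The
parabola `C : (x₁ − x₀)² = x₀` is tangent to the rational direction `(1 : 1 : 0)` at infinity; its
branch there is `x₀ = s^{-2}`, `x₁ = (1 + s)s^{-2}` — `(k, M) = (2, 2)`, `Φ(s) = 1 + s`, so the
SUBLEADING Puiseux coefficient is `Φ′(0) = 1`, and `Re(Φ′(0)·z) = Re z ≠ 0` for the square root
`z = √π(1 + i)` of `2πi`.  By file XXVI (growth from the second phase coefficient), for every
`θ ≠ 0` the constant-fibre cylinder `{(x₁ − x₀)² − x₀ = 0, y₀ = θ} ⊆ ℂ² × ℂ²` has Zariski-dense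
exponential points, and it is in Mantova–Masser's case (`C` irreducible — `x₀` is not a square in
`ℂ[x₀]` —, not a line: `(0,0)`, `(1,2)`, `(1,0)`):
**`unprojectedDensityQuestion_diagonalParabola_constFibre`**.  The first decided base curve with a
rational asymptotic direction that is not a graph over `x₀` of the kind of gens 22–26.  Decided
instance of an OPEN question (Mantova–Masser, PLMS 2024 §1 p. 5); EC(3,2) OPEN; NOT Schanuel's
conjecture (neither used nor implied); EAC ⇏ SC.
-/

noncomputable section

open Filter Topology Set Complex MvPolynomial
open Literature.NumberTheory.Transcendental Literature.ModelTheory.Zilber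
open Literature.ModelTheory.ExponentialFields

set_option linter.dupNamespace false

namespace Summit.Schanuel.Schanuel.Theorems

/-! ## Part A. `(x₁ − x₀)² − x₀` is irreducible (`x₀` is not a square) -/

/-- `t² − 2s·t + (s² − s)` is irreducible in `ℂ[s][t]`: a factorisation `(t + c₁)(t + c₂)` would give
`(c₁ − c₂)² = 4s`, and `4s` is not a square in `ℂ[s]` (odd degree). [folklore] -/
theorem irreducible_diagonalParabola_row :
    Irreducible (Polynomial.X ^ 2 + Polynomial.C (-(2 : Polynomial ℂ) * Polynomial.X) * Polynomial.X +
      Polynomial.C (Polynomial.X ^ 2 - Polynomial.X : Polynomial ℂ)) := by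
  set f : Polynomial (Polynomial ℂ) := Polynomial.X ^ 2 +
    Polynomial.C (-(2 : Polynomial ℂ) * Polynomial.X) * Polynomial.X +
    Polynomial.C (Polynomial.X ^ 2 - Polynomial.X : Polynomial ℂ) with hf
  have hmonic : f.Monic := by
    rw [hf]
    apply Polynomial.Monic.add_of_left
    · apply Polynomial.Monic.add_of_left (Polynomial.monic_X_pow 2)
      exact lt_of_le_of_lt (Polynomial.degree_C_mul_X_le _)
        (by rw [Polynomial.degree_X_pow]; exact_mod_cast (by norm_num : (1 : ℕ) < 2))
    · refine lt_of_le_of_lt Polynomial.degree_C_le ?_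
      rw [Polynomial.degree_add_eq_left_of_degree_lt]
      · rw [Polynomial.degree_X_pow]; exact_mod_cast (by norm_num : (0 : ℕ) < 2)
      · exact lt_of_le_of_lt (Polynomial.degree_C_mul_X_le _)
          (by rw [Polynomial.degree_X_pow]; exact_mod_cast (by norm_num : (1 : ℕ) < 2))
  have hdeg : f.natDegree = 2 := by
    rw [hf]
    compute_degree!
  by_contra hirr
  obtain ⟨c₁, c₂, hmul, hadd⟩ :=
    (hmonic.not_irreducible_iff_exists_add_mul_eq_coeff hdeg).1 hirr
  have h0 : f.coeff 0 = Polynomial.X ^ 2 - Polynomial.X := by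
    rw [hf, Polynomial.coeff_add, Polynomial.coeff_add, Polynomial.coeff_C_zero,
      Polynomial.coeff_X_pow, if_neg (by norm_num), Polynomial.mul_coeff_zero,
      Polynomial.coeff_C_zero, Polynomial.coeff_X_zero]
    ring
  have h1 : f.coeff 1 = -(2 : Polynomial ℂ) * Polynomial.X := by
    rw [hf, Polynomial.coeff_add, Polynomial.coeff_add, Polynomial.coeff_C, if_neg (by norm_num),
      Polynomial.coeff_X_pow, if_neg (by norm_num), Polynomial.coeff_C_mul, Polynomial.coeff_X_one]
    ring
  rw [h0] at hmul
  rw [h1] at hadd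
  -- `(c₁ − c₂)² = (c₁ + c₂)² − 4c₁c₂ = 4X² − 4(X² − X) = 4X`
  have hsq : (c₁ - c₂) ^ 2 = Polynomial.C (4 : ℂ) * Polynomial.X := by
    have e : (c₁ - c₂) ^ 2 = (c₁ + c₂) ^ 2 - 4 * (c₁ * c₂) := by ring
    rw [e, ← hadd, ← hmul, Polynomial.C_ofNat]
    ring
  have hd := congrArg Polynomial.natDegree hsq
  rw [Polynomial.natDegree_pow, Polynomial.natDegree_C_mul_X _ (by norm_num)] at hd
  omega

/-- Evaluation of `(x₁ − x₀)² − x₀`. -/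
theorem eval_diagonalParabolaMv (x : Fin 2 → ℂ) :
    MvPolynomial.eval x ((X 1 - X 0) ^ 2 - X 0 : MvPolynomial (Fin 2) ℂ) = (x 1 - x 0) ^ 2 - x 0 := by
  simp

/-- `(x₁ − x₀)² − x₀` and its rows. -/
theorem eval_diagonalParabolaMv_rows (x y : ℂ) :
    MvPolynomial.eval ![x, y] ((X 1 - X 0) ^ 2 - X 0 : MvPolynomial (Fin 2) ℂ) =
      ((Polynomial.X ^ 2 + Polynomial.C (-(2 : Polynomial ℂ) * Polynomial.X) * Polynomial.X +
        Polynomial.C (Polynomial.X ^ 2 - Polynomial.X : Polynomial ℂ)).map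
        (Polynomial.evalRingHom x)).eval y := by
  rw [eval_diagonalParabolaMv]
  simp
  ring

/-- `(x₁ − x₀)² − x₀` is irreducible in `ℂ[x₀, x₁]`. [folklore] -/
theorem irreducible_diagonalParabolaMv :
    Irreducible ((X 1 - X 0) ^ 2 - X 0 : MvPolynomial (Fin 2) ℂ) :=
  (irreducible_rows_iff eval_diagonalParabolaMv_rows).2 irreducible_diagonalParabola_row

/-! ## Part B. Density via the second phase coefficient -/

/-- **Constant fibres over the diagonal parabola are dense** (`θ ≠ 0`): branch `x₀ = s^{-2}`,
`x₁ = (1 + s)s^{-2}`, `Φ′(0) = 1`, `Re(√π(1 + i)) ≠ 0`; file XXVI.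
[cite: MantovaMasser2023, §1 Further remarks, p. 5 (the question, open in general)] (new) -/
theorem unprojectedDense_diagonalParabola_constFibre {θ : ℂ} (hθ : θ ≠ 0) :
    UnprojectedDense {w : Fin 2 ⊕ Fin 2 → ℂ |
      MvPolynomial.eval ![w (Sum.inl 0), w (Sum.inl 1)]
          ((X 1 - X 0) ^ 2 - X 0 : MvPolynomial (Fin 2) ℂ) = 0 ∧
      w (Sum.inr 0) = MvPolynomial.eval ![w (Sum.inl 0), w (Sum.inl 1)]
        (MvPolynomial.C θ : MvPolynomial (Fin 2) ℂ)} := by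
  have hS := isIrreducibleClosed_curveGraphFibre (MvPolynomial.C θ : MvPolynomial (Fin 2) ℂ)
    irreducible_diagonalParabolaMv
  have hdim := zariskiDim_curveGraphFibre (MvPolynomial.C θ : MvPolynomial (Fin 2) ℂ)
    irreducible_diagonalParabolaMv
  -- `Φ(s) = 1 + s`
  have hΦan : AnalyticAt ℂ (fun s : ℂ => 1 + s) 0 := analyticAt_const.add analyticAt_id
  have hΦ' : deriv (fun s : ℂ => 1 + s) 0 = 1 := by
    rw [deriv_const_add, deriv_id'']
  have hψan : AnalyticAt ℂ (fun _ : ℂ => θ) 0 := analyticAt_const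
  -- the direction: `z = √π (1 + i)`, `z² = 2πi`, `Re z = √π ≠ 0`
  have hdir : ∃ z : ℂ, z ^ 2 = 2 * Real.pi * I ∧
      (deriv (fun s : ℂ => 1 + s) 0 * z ^ (2 - 1)).re ≠ 0 := by
    refine ⟨(Real.sqrt Real.pi : ℂ) * (1 + I), ?_, ?_⟩
    · have hpi : ((Real.sqrt Real.pi : ℂ)) ^ 2 = Real.pi := by
        rw [← Complex.ofReal_pow, Real.sq_sqrt Real.pi_pos.le]
      calc ((Real.sqrt Real.pi : ℂ) * (1 + I)) ^ 2
          = ((Real.sqrt Real.pi : ℂ)) ^ 2 * ((1 + I) ^ 2) := by ring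
        _ = Real.pi * (1 + 2 * I + I ^ 2) := by rw [hpi]; ring
        _ = 2 * Real.pi * I := by rw [Complex.I_sq]; ring
    · rw [hΦ', one_mul, show (2 - 1 : ℕ) = 1 from rfl, pow_one]
      have hre : (((Real.sqrt Real.pi : ℂ)) * (1 + I)).re = Real.sqrt Real.pi := by
        simp [Complex.mul_re]
      rw [hre]
      exact (Real.sqrt_pos.2 Real.pi_pos).ne'
  have hgerm : ∀ᶠ s in 𝓝[≠] (0 : ℂ),
      (Sum.elim ![(s ^ 2)⁻¹, (fun s : ℂ => 1 + s) s * (s ^ 2)⁻¹]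
          ![(fun _ : ℂ => θ) s, Complex.exp ((fun s : ℂ => 1 + s) s * (s ^ 2)⁻¹)] :
            Fin 2 ⊕ Fin 2 → ℂ) ∈
        {w : Fin 2 ⊕ Fin 2 → ℂ |
          MvPolynomial.eval ![w (Sum.inl 0), w (Sum.inl 1)]
              ((X 1 - X 0) ^ 2 - X 0 : MvPolynomial (Fin 2) ℂ) = 0 ∧
          w (Sum.inr 0) = MvPolynomial.eval ![w (Sum.inl 0), w (Sum.inl 1)]
            (MvPolynomial.C θ : MvPolynomial (Fin 2) ℂ)} := by
    filter_upwards [self_mem_nhdsWithin] with s (hs : s ≠ 0)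
    refine ⟨?_, ?_⟩
    · simp only [Sum.elim_inl, Matrix.cons_val_zero, Matrix.cons_val_one]
      rw [eval_diagonalParabolaMv]
      simp only [Matrix.cons_val_zero, Matrix.cons_val_one]
      field_simp
      ring
    · simp only [Sum.elim_inr, Matrix.cons_val_zero, MvPolynomial.eval_C]
  exact unprojectedDense_branch_growth_of_second_coeff hS (le_of_eq hdim) (le_refl 2) (le_refl 2)
    hψan hθ rfl hΦan hdir hgerm

/-! ## Part C. The case certificate, and case ∧ dense -/

/-- **The constant-fibre cylinder over the diagonal parabola is in Mantova–Masser's case**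
(`θ ≠ 0`): the points `(0,0)`, `(1,2)`, `(1,0)` of the parabola are not collinear. (new) -/
theorem mmCase_diagonalParabola_constFibre {θ : ℂ} (hθ : θ ≠ 0) :
    MMCaseDimPiOneFree {w : Fin 2 ⊕ Fin 2 → ℂ |
      MvPolynomial.eval ![w (Sum.inl 0), w (Sum.inl 1)]
          ((X 1 - X 0) ^ 2 - X 0 : MvPolynomial (Fin 2) ℂ) = 0 ∧
      w (Sum.inr 0) = MvPolynomial.eval ![w (Sum.inl 0), w (Sum.inl 1)]
        (MvPolynomial.C θ : MvPolynomial (Fin 2) ℂ)} := by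
  refine mmCase_curveGraphFibre irreducible_diagonalParabolaMv ?_ ?_
  · exact ⟨![0, 0], by rw [eval_diagonalParabolaMv]; simp, by rw [MvPolynomial.eval_C]; exact hθ⟩
  · intro m hm c
    by_cases h1 : (m 0 : ℂ) * 0 + (m 1 : ℂ) * 0 ≠ c
    · exact ⟨![0, 0], by rw [eval_diagonalParabolaMv]; simp, by simpa using h1⟩
    by_cases h2 : (m 0 : ℂ) * 1 + (m 1 : ℂ) * 2 ≠ c
    · exact ⟨![1, 2], by rw [eval_diagonalParabolaMv]; norm_num, by simpa using h2⟩
    push Not at h1 h2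
    refine ⟨![1, 0], by rw [eval_diagonalParabolaMv]; norm_num, ?_⟩
    simp only [Matrix.cons_val_zero, Matrix.cons_val_one, mul_zero, add_zero, mul_one]
    intro h3
    have hc : c = 0 := by rw [← h1]; ring
    have hm0 : (m 0 : ℂ) = 0 := by rw [h3, hc]
    have hm1 : (m 1 : ℂ) = 0 := by
      have h : (m 1 : ℂ) * 2 = 0 := by linear_combination h2 - h3
      rcases mul_eq_zero.1 h with h | h
      · exact h
      · norm_num at h
    apply hm
    funext i
    fin_cases i
    · exact_mod_cast hm0
    · exact_mod_cast hm1

/-- **Mantova–Masser's question for constant fibres over the diagonal parabola: case ∧ dense**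
(`θ ≠ 0`). [cite: MantovaMasser2023, §1 Further remarks, p. 5 (the question, open in general)]
(new) -/
theorem unprojectedDensityQuestion_diagonalParabola_constFibre {θ : ℂ} (hθ : θ ≠ 0) :
    MMCaseDimPiOneFree {w : Fin 2 ⊕ Fin 2 → ℂ |
        MvPolynomial.eval ![w (Sum.inl 0), w (Sum.inl 1)]
            ((X 1 - X 0) ^ 2 - X 0 : MvPolynomial (Fin 2) ℂ) = 0 ∧
        w (Sum.inr 0) = MvPolynomial.eval ![w (Sum.inl 0), w (Sum.inl 1)]
          (MvPolynomial.C θ : MvPolynomial (Fin 2) ℂ)} ∧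
      UnprojectedDense {w : Fin 2 ⊕ Fin 2 → ℂ |
        MvPolynomial.eval ![w (Sum.inl 0), w (Sum.inl 1)]
            ((X 1 - X 0) ^ 2 - X 0 : MvPolynomial (Fin 2) ℂ) = 0 ∧
        w (Sum.inr 0) = MvPolynomial.eval ![w (Sum.inl 0), w (Sum.inl 1)]
          (MvPolynomial.C θ : MvPolynomial (Fin 2) ℂ)} :=
  ⟨mmCase_diagonalParabola_constFibre hθ, unprojectedDense_diagonalParabola_constFibre hθ⟩

/-- **Plain coordinates**: `{(x₁ − x₀)² − x₀ = 0, y₀ = θ}` (`θ ≠ 0`) is in the case AND dense.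
[cite: MantovaMasser2023, §1 Further remarks, p. 5 (the question, open in general)] (new) -/
theorem unprojectedDensityQuestion_diagonalParabola_constFibre' {θ : ℂ} (hθ : θ ≠ 0) :
    MMCaseDimPiOneFree {w : Fin 2 ⊕ Fin 2 → ℂ |
        (w (Sum.inl 1) - w (Sum.inl 0)) ^ 2 - w (Sum.inl 0) = 0 ∧ w (Sum.inr 0) = θ} ∧
      UnprojectedDense {w : Fin 2 ⊕ Fin 2 → ℂ |
        (w (Sum.inl 1) - w (Sum.inl 0)) ^ 2 - w (Sum.inl 0) = 0 ∧ w (Sum.inr 0) = θ} := by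
  have e : {w : Fin 2 ⊕ Fin 2 → ℂ |
        MvPolynomial.eval ![w (Sum.inl 0), w (Sum.inl 1)]
            ((X 1 - X 0) ^ 2 - X 0 : MvPolynomial (Fin 2) ℂ) = 0 ∧
        w (Sum.inr 0) = MvPolynomial.eval ![w (Sum.inl 0), w (Sum.inl 1)]
          (MvPolynomial.C θ : MvPolynomial (Fin 2) ℂ)} =
      {w : Fin 2 ⊕ Fin 2 → ℂ |
        (w (Sum.inl 1) - w (Sum.inl 0)) ^ 2 - w (Sum.inl 0) = 0 ∧ w (Sum.inr 0) = θ} := by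
    ext w
    simp only [Set.mem_setOf_eq, eval_diagonalParabolaMv, MvPolynomial.eval_C, Matrix.cons_val_zero,
      Matrix.cons_val_one]
  have h := unprojectedDensityQuestion_diagonalParabola_constFibre hθ
  rw [e] at h
  exact h

end Summit.Schanuel.Schanuel.Theorems

end
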